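import Summits.NavierStokesRegularity.FluidComputer.TubeRestart
import Summits.NavierStokesRegularity.FluidComputer.TubeSection
import HarnessLib

/-!
# Clock-section restart of the certified tube, instantiated: a forced window that sweeps the clock
# window of recorded slice `k` inside its fibre and energy band reaches the loaded, correctly signed
# output within `TfromT k + T₃L` of the crossing instant

HONEST FRAMING (cell `pub-fluidc`, blueprint seat bp3, gen 16): low prior, high value-of-information
experiment on Tao's machine paradigm; NOT a claim that NS blows up. Everything here concerns the
5-mode quadratic, energy-conserving TRUNCATION `thresholdCircuit` with an ABSTRACT forcing of sup-size
`δ`; nothing is proved about the Navier–Stokes equations, the ramp, stage 4 or the cascade.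

Companion of `TubeSection.lean` (the generic clock-section restart, IVT + `IsForcedWindow.shift`) and
`TubeRestart.lean` (gen 15: the stage served from every recorded slice, `slice_reach_outputAbove`);
this file is their composition and imports both, so it lands LAST. Level one; every level `c > 0`
follows by the homogeneity transport of `TubeRestart.sliceStageLevel` / bp1's `certificateRescale`.

[cite: Tao2016AveragedNS, §5.5 Thm 5.3 (5.5)]
-/

noncomputable section

open Set Filter Topology
open scoped Pointwise

namespace Summit.NavierStokesRegularity.FluidComputer

open Literature.Analysis.FluidPDE.Tao2016AveragedNS
open Literature.Analysis.FluidPDE.FluidComputer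
open Literature.Analysis.FluidPDE.FluidComputer.TubeTable
open Literature.Analysis.FluidPDE.FluidComputer.ThresholdLevelTable (Gt)
open Literature.Analysis.FluidPDE.FluidComputer.ThresholdLevelTableL (T₃L)

namespace TubeStage

/-- The gen-15 slice IS the section of the recorded box. [folklore] -/
theorem slice_eq_boxSection (k : ℕ) : Slice k = boxSection ((sT k).B.toR 60) := rfl

/-- The gen-15 restart class IS the section with its energy band. [folklore] -/
theorem sliceE_eq (k : ℕ) : SliceE k = boxSection ((sT k).B.toR 60) ∩ energyBand k := rfl

/-- **SLICE RESTART FROM A CLOCK SWEEP ⇒ LOADED, CORRECTLY SIGNED OUTPUT** (`k < 48`, level one,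
defect `Gt.δ`). Let `x` be a `Gt.δ`-forced window of length `τ ≥ t₂ + TfromT k + T₃L` which, on
`[t₁, t₂]` (`0 ≤ t₁ ≤ t₂`), lies in the fibre of slice `k` (carrier, trigger, rotor) and in its energy
band, with clock at most the slice's upper clock edge at `t₁` and at least its lower edge at `t₂`. Then
at some instant `t ∈ [t₁, t₂]` the state is in `SliceE k`, and the output mode is loaded with the
design sign, `ã ≥ zL = 0.9604`, at some time in `[t, t + TfromT k + T₃L]`.
[cite: Tao2016AveragedNS, §5.5 Thm 5.3 (5.5)] -/
theorem slice_section_reach_outputAbove {k : ℕ} (hk : k < NT) {τ t₁ t₂ : ℝ} {x : ℝ → Fin 5 → ℝ}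
    (hW : IsForcedWindow Gt.ε Gt.σ Gt.ν Gt.μ Gt.r Gt.κ Gt.δ τ x) (h0 : 0 ≤ t₁) (h12 : t₁ ≤ t₂)
    (hτ : t₂ + (TfromT k + T₃L) ≤ τ)
    (hlo : x t₁ 1 ≤ ((sT k).B.toR 60).bh) (hhi : ((sT k).B.toR 60).bl ≤ x t₂ 1)
    (hF : ∀ t ∈ Icc t₁ t₂, x t ∈ fibre ((sT k).B.toR 60) ∩ energyBand k) :
    ∃ t ∈ Icc t₁ t₂, x t ∈ SliceE k ∧
      ∃ s ∈ Icc t (t + (TfromT k + T₃L)), x s ∈ outputAbove zL := by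
  have hT : 0 ≤ TfromT k + T₃L := by
    have h1 := TfromT_nonneg k
    have h2 : (0 : ℝ) ≤ T₃L := by norm_num [T₃L]
    linarith
  exact slice_section_restart hk.le hW h0 h12 hT hτ hlo hhi hF
    fun y hy hy0 => slice_reach_outputAbove hk hy hy0

/-- **The same with the sweep certified by the clock rate** (`TubeSection.clock_ge_of_linear`): the
hypothesis at `t₂` is replaced by `εa² − νc² ≥ m + Gt.δ` on `[0, τ)` with `m > 0` and
`t₂ ≥ (bl − b(0))/m`. [cite: Tao2016AveragedNS, §5.5 Thm 5.3 (5.5)] -/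
theorem slice_section_reach_outputAbove_of_rate {k : ℕ} (hk : k < NT) {τ t₁ t₂ m : ℝ}
    {x : ℝ → Fin 5 → ℝ} (hW : IsForcedWindow Gt.ε Gt.σ Gt.ν Gt.μ Gt.r Gt.κ Gt.δ τ x)
    (h0 : 0 ≤ t₁) (h12 : t₁ ≤ t₂) (hτ : t₂ + (TfromT k + T₃L) ≤ τ)
    (hlo : x t₁ 1 ≤ ((sT k).B.toR 60).bh) (hm0 : 0 < m)
    (hm : ∀ t ∈ Ico 0 τ, m + Gt.δ ≤ Gt.ε * x t 0 ^ 2 - Gt.ν * x t 2 ^ 2)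
    (ht₂ : (((sT k).B.toR 60).bl - x 0 1) / m ≤ t₂)
    (hF : ∀ t ∈ Icc t₁ t₂, x t ∈ fibre ((sT k).B.toR 60) ∩ energyBand k) :
    ∃ t ∈ Icc t₁ t₂, x t ∈ SliceE k ∧
      ∃ s ∈ Icc t (t + (TfromT k + T₃L)), x s ∈ outputAbove zL :=
  slice_section_reach_outputAbove hk hW h0 h12 hτ hlo
    (clock_ge_of_linear hW hm0 hm ⟨h0.trans h12, by
      have h1 := TfromT_nonneg k
      have h2 : (0 : ℝ) ≤ T₃L := by norm_num [T₃L]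
      linarith⟩ ht₂) hF

end TubeStage

end Summit.NavierStokesRegularity.FluidComputer
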